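import Literature.NumberTheory.EllipticCurves.EichlerShimuraPeriodsRankProofs
import Literature.NumberTheory.EllipticCurves.NewformsCoeffFieldLatticeProofs
import HarnessLib

/-!
# A Hecke-stable full lattice in `S_k(Γ₀(N))_ℝ` for every weight: discharge of
# `gamma0_exists_heckeStableLattice`

This file proves `gamma0_exists_heckeStableLattice N k` (Shimura 1971, Thm. 3.48 / (3.5.20) for
`Γ₀(N)`: `S_k(Γ₀(N))` has a basis whose `ℤ`-span is stable under all `T_p`, `p` prime, and which is an
`ℝ`-basis of its real span) for **all** `N ≥ 1` and `k ∈ ℤ`: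

* `gamma0_exists_heckeStableLattice_holds`.

The cases `k < 2`, `k` odd and `k = 2` are in `NewformsCoeffFieldLatticeProofs`
(`gamma0_exists_heckeStableLattice_of_not_even_or_lt_four`, from the weight-2 modular symbols). For
even `k = n + 2 ≥ 4` the lattice is the dual of the **cuspidal period lattice**
`C ⊆ S_k(Γ₀(N))^∨` of `EichlerShimuraPeriodsRankProofs` (integral combinations `∑ a_{γ,q} λ_{γ,q}`
of Eichler–Shimura period functionals `λ_{γ,q}(f) = ∫_{z₀}^{γ z₀} f(z) det((z,1), γq)ⁿ dz` with
total boundary `∑ a_{γ,q}(q₁ⁿ - (γq)₁ⁿ) = 0`), through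
`gamma0_exists_heckeStableLattice_of_dual_basis`:

1. `C` is **Hecke stable** (`dualMap_heckeT_mem_cuspidalLatticeK`): by Shimura's formula
   `T_p^∨ λ_{γ,q} = ∑ᵢ λ_{γ'ᵢ, β_{σ(i)}q}` (`dualMap_heckeT_periodFunctionalK`, `βᵢ γ = γ'ᵢ β_{σ(i)}`)
   and the boundary identity `∑ᵢ ∂(γ'ᵢ, β_{σ(i)}q) = (∑ᵢ (βᵢ)₁₁ⁿ) ∂(γ, q)`
   (`sum_bdryInt_heckePerm`, `exists_hecke_transport`; the `βᵢ` are upper triangular and `σ` is a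
   bijection);
2. `C` **separates real parts** (`eq_zero_of_forall_re_cuspidalLatticeK_eq_zero`): if
   `re φ(f) = 0` on `C` then `x ↦ re (∑ a λ)(f)` factors through the total boundary, i.e.
   `re c_f(γ)(q) = κ (q₁ⁿ - (γq)₁ⁿ)` is the real coboundary of `-κ vⁿ`, so `f = 0` by the real
   injectivity of the period map (`eq_zero_of_re_periodFn_int_coboundary`, maximum principle);
   hence `ℝC = S_k^∨` (`cuspidalLatticeK_span_real_eq_top`);
3. `C` is finitely generated (inside the finitely generated `periodLatticeK`) of `ℚ`-rank
   `≤ 2 dim_ℂ S_k` (`finrank_span_cuspidalLatticeK_le`, Manin's presentation and the dimension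
   inequality), so a `ℤ`-basis of `C` has `2 dim_ℂ S_k = dim_ℝ S_k^∨` elements spanning `S_k^∨`
   over `ℝ`: it is an `ℝ`-basis with Hecke-stable `ℤ`-span (`gamma0_exists_heckeStableLattice_even`).

## References

* [Shimura1971] G. Shimura, *Introduction to the Arithmetic Theory of Automorphic Functions*,
  Princeton Univ. Press, 1971 — Thm. 3.48, (3.5.20) p. 84; Ch. 8: Thm. 8.4, (8.3.2), Prop. 8.5,
  Prop. 8.6 and §8.4 pp. 239–241.
* [Manin1972] Ju. I. Manin, *Parabolic points and zeta functions of modular curves*, 1972, §1.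
* [Merel1994] L. Merel, *Universal Fourier expansions of modular forms*, LNM 1585 (1994), Thm. 2.
-/

noncomputable section

open scoped MatrixGroups ModularForm

open CongruenceSubgroup Complex Matrix.SpecialLinearGroup ModularGroup

namespace Literature.NumberTheory.EllipticCurves.ModularForms

/-! ### Hecke stability of the cuspidal lattice -/

section Hecke

variable {N : ℕ} [NeZero N] (n : ℕ) {p : ℕ}

/-- `(βᵢ v)₁ = (βᵢ)₁₁ v₁`: the Hecke representatives are upper triangular. [folklore] -/
theorem heckeRep_mulVec_one (i : Option (ZMod p)) (v : Fin 2 → ℤ) :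
    (heckeRep p i).mulVec v 1 = heckeRep p i 1 1 * v 1 := by
  cases i <;> simp [heckeRep, Matrix.mulVec, dotProduct, Fin.sum_univ_two]

variable [NeZero p] (hp : p.Prime)
include hp

omit [NeZero N] in
/-- **The boundary of a Hecke translate**: `∑ᵢ ∂(γ'ᵢ, β_{σ(i)} q) = c_p ∂(γ, q)` with
`c_p = ∑ᵢ (βᵢ)₁₁ⁿ`, because `γ'ᵢ β_{σ(i)} = βᵢ γ`, the `βᵢ` are upper triangular and `σ` permutes
the index set. [folklore] -/
theorem sum_bdryInt_heckePerm (γ : Gamma0 N) (q : Fin 2 → ℤ) :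
    ∑ i : HeckeIdx N p,
        bdryInt n (heckePermElt hp γ i, (heckeRep p (heckePerm hp γ i).1).mulVec q) =
      (∑ i : HeckeIdx N p, (heckeRep p i.1 1 1) ^ n) * bdryInt n (γ, q) := by
  have key : ∀ i : HeckeIdx N p,
      bdryInt n (heckePermElt hp γ i, (heckeRep p (heckePerm hp γ i).1).mulVec q) =
        (heckeRep p (heckePerm hp γ i).1 1 1) ^ n * q 1 ^ n -
          (heckeRep p i.1 1 1) ^ n * (((γ : SL(2, ℤ)) : Matrix (Fin 2) (Fin 2) ℤ).mulVec q 1) ^ n := by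
    intro i
    simp only [bdryInt]
    rw [Matrix.mulVec_mulVec, heckePermElt_spec hp γ i, ← Matrix.mulVec_mulVec, heckeRep_mulVec_one,
      heckeRep_mulVec_one, mul_pow, mul_pow]
  simp_rw [key]
  rw [Finset.sum_sub_distrib, ← Finset.sum_mul, ← Finset.sum_mul, bdryInt, mul_sub]
  have hσ := Equiv.sum_comp (heckePermEquiv hp γ) (fun i : HeckeIdx N p ↦ heckeRep p i.1 1 1 ^ n)
  simp only [heckePermEquiv_apply] at hσ
  rw [hσ]

/-- **Transport of formal combinations under `T_p`** (`(γ, q) ↦ ∑ᵢ (γ'ᵢ, β_{σ(i)} q)`): for every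
integral combination `x` there is one realising `T_p^∨` of its functional (Shimura's formula
`T_p^∨ λ_{γ,q} = ∑ᵢ λ_{γ'ᵢ, β_{σ(i)}q}`, `dualMap_heckeT_periodFunctionalK`) with total boundary
multiplied by `c_p = ∑ᵢ (βᵢ)₁₁ⁿ`. [cite: Shimura1971, §8.3 (8.3.2) and Prop. 8.5] -/
theorem exists_hecke_transport (x : (Gamma0 N × (Fin 2 → ℤ)) →₀ ℤ) :
    ∃ y : (Gamma0 N × (Fin 2 → ℤ)) →₀ ℤ,
      genMap n y = (heckeT (Gamma0 N) (n + 2) p).dualMap (genMap n x) ∧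
      bdryF n y = (∑ i : HeckeIdx N p, (heckeRep p i.1 1 1) ^ n) * bdryF n x := by
  induction x using Finsupp.induction_linear with
  | zero => exact ⟨0, by simp, by simp⟩
  | add x x' hx hx' =>
    obtain ⟨y, hy1, hy2⟩ := hx
    obtain ⟨y', hy'1, hy'2⟩ := hx'
    exact ⟨y + y', by simp only [map_add, hy1, hy'1], by simp only [map_add, hy2, hy'2, mul_add]⟩
  | single gq a =>
    refine ⟨a • ∑ i : HeckeIdx N p,
      Finsupp.single (heckePermElt hp gq.1 i, (heckeRep p (heckePerm hp gq.1 i).1).mulVec gq.2)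
        (1 : ℤ), ?_, ?_⟩
    · rw [map_zsmul, map_sum, genMap_single, map_zsmul, dualMap_heckeT_periodFunctionalK hp]
      congr 1
      refine Finset.sum_congr rfl fun i _ ↦ ?_
      rw [genMap_single, one_smul]
    · rw [map_zsmul, map_sum, bdryF_single, smul_eq_mul]
      simp only [bdryF_single, one_mul]
      rw [sum_bdryInt_heckePerm n hp]
      ring

/-- **The Hecke operators `T_p^∨` preserve the cuspidal period lattice.** [cite: Shimura1971, §8.4 p. 240] -/
theorem dualMap_heckeT_mem_cuspidalLatticeK {φ : Module.Dual ℂ (CuspForm (Gamma0 N) (n + 2))}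
    (hφ : φ ∈ cuspidalLatticeK (N := N) n) :
    (heckeT (Gamma0 N) (n + 2) p).dualMap φ ∈ cuspidalLatticeK (N := N) n := by
  obtain ⟨x, hx, rfl⟩ := AddSubgroup.mem_map.mp hφ
  obtain ⟨y, hy1, hy2⟩ := exists_hecke_transport n hp x
  refine AddSubgroup.mem_map.mpr ⟨y, ?_, hy1⟩
  rw [AddMonoidHom.mem_ker] at hx ⊢
  rw [hy2, hx, mul_zero]

end Hecke

/-! ### Real separation by the cuspidal lattice -/

section Separation

variable {N : ℕ} [NeZero N] (n : ℕ)

omit [NeZero N] in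
/-- `momPoly (c δₙ) v = c v₁ⁿ`. [folklore] -/
theorem momPoly_smul_single_last (c : ℝ) (v : Fin 2 → ℝ) :
    momPoly n (c • (Pi.single (Fin.last n) 1 : Fin (n + 1) → ℝ)) v = c * v 1 ^ n := by
  rw [momPoly_apply, Finset.sum_eq_single (Fin.last n)
    (fun j _ hj ↦ by simp [Pi.single_eq_of_ne hj]) (by simp)]
  simp

omit [NeZero N] in
/-- `rmat γ` acts on integer vectors through the integer matrix. [folklore] -/
theorem rmat_mulVec_intCast (γ : SL(2, ℤ)) (q : Fin 2 → ℤ) :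
    (rmat γ).mulVec (fun i ↦ (q i : ℝ)) =
      fun i ↦ ((((γ : Matrix (Fin 2) (Fin 2) ℤ)).mulVec q) i : ℝ) := by
  funext i
  simp [rmat, Matrix.mulVec, dotProduct, Fin.sum_univ_two]

/-- `re (genMap (a • x))(f) = a · re (genMap x)(f)`. [folklore] -/
theorem re_genMap_zsmul (f : CuspForm (Gamma0 N) (n + 2)) (a : ℤ)
    (x : (Gamma0 N × (Fin 2 → ℤ)) →₀ ℤ) :
    (genMap n (a • x) f).re = a * (genMap n x f).re := by
  rw [map_zsmul, ← Int.cast_smul_eq_zsmul ℂ, LinearMap.smul_apply, smul_eq_mul, Complex.mul_re]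
  simp

/-- **Real separation by the cuspidal lattice** (even `n`): if `re φ(f) = 0` for all `φ ∈ C`, then
`f = 0`. The additive map `x ↦ re (∑ a λ)(f)` on formal combinations kills the kernel of the total
boundary, so it is `κ ·` (total boundary): `re c_f(γ)(q) = κ (q₁ⁿ - (γq)₁ⁿ)`, the real coboundary
of the vector `-κ δₙ` (`momPoly (-κδₙ) v = -κ v₁ⁿ`); the real injectivity of the period map
(`eq_zero_of_re_periodFn_int_coboundary`) gives `f = 0`. [cite: Shimura1971, Thm. 8.4] -/
theorem eq_zero_of_forall_re_cuspidalLatticeK_eq_zero (hn : Even n) (f : CuspForm (Gamma0 N) (n + 2))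
    (h : ∀ φ ∈ cuspidalLatticeK (N := N) n, (φ f).re = 0) : f = 0 := by
  have hρ : ∀ x : (Gamma0 N × (Fin 2 → ℤ)) →₀ ℤ, bdryF n x = 0 → (genMap n x f).re = 0 :=
    fun x hx ↦ h _ ⟨x, hx, rfl⟩
  obtain ⟨κ, hκ⟩ : ∃ κ : ℝ, ∀ x : (Gamma0 N × (Fin 2 → ℤ)) →₀ ℤ,
      (genMap n x f).re = κ * (bdryF n x : ℝ) := by
    by_cases hall : ∀ x : (Gamma0 N × (Fin 2 → ℤ)) →₀ ℤ, bdryF n x = 0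
    · exact ⟨0, fun x ↦ by rw [hρ x (hall x), zero_mul]⟩
    · push Not at hall
      obtain ⟨x₀, hx₀⟩ := hall
      refine ⟨(genMap n x₀ f).re / (bdryF n x₀ : ℝ), fun x ↦ ?_⟩
      have h0 : bdryF n (bdryF n x₀ • x - bdryF n x • x₀) = 0 := by
        rw [map_sub, map_zsmul, map_zsmul, smul_eq_mul, smul_eq_mul]
        ring
      have h1 := hρ _ h0
      rw [map_sub, LinearMap.sub_apply, Complex.sub_re, re_genMap_zsmul, re_genMap_zsmul,
        sub_eq_zero] at h1
      have hd : (bdryF n x₀ : ℝ) ≠ 0 := by exact_mod_cast hx₀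
      field_simp
      linarith
  refine eq_zero_of_re_periodFn_int_coboundary n hn f ((-κ) • Pi.single (Fin.last n) 1) fun γ q ↦ ?_
  have h1 := hκ (Finsupp.single (γ, q) 1)
  rw [genMap_single, one_smul, periodFunctionalK_apply, bdryF_single, one_mul] at h1
  rw [h1, rmat_mulVec_intCast, momPoly_smul_single_last, momPoly_smul_single_last, bdryInt]
  push_cast
  ring

/-- **The cuspidal lattice spans the dual space over `ℝ`** (even `n`): `ℝC = S_{n+2}(Γ₀(N))^∨`. [cite: Shimura1971, Thm. 8.4 and (3.5.20)] -/
theorem cuspidalLatticeK_span_real_eq_top (hn : Even n) :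
    Submodule.span ℝ (cuspidalLatticeK (N := N) n :
      Set (Module.Dual ℂ (CuspForm (Gamma0 N) (n + 2)))) = ⊤ := by
  haveI : FiniteDimensional ℂ (CuspForm (Gamma0 N) (n + 2)) :=
    finiteDimensional_cuspForm_gamma0 N (n + 2)
  by_contra htop
  obtain ⟨ℓ, hℓ, hker⟩ := Submodule.exists_le_ker_of_lt_top _ (lt_top_iff_ne_top.mpr htop)
  let ψ : Module.Dual ℂ (Module.Dual ℂ (CuspForm (Gamma0 N) (n + 2))) := Module.Dual.extendRCLike ℓ
  have hψ : ∀ φ, (ψ φ).re = ℓ φ := fun φ ↦ Module.Dual.re_extendRCLike_apply (𝕜 := ℂ) ℓ φ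
  obtain ⟨f, hf⟩ := (Module.evalEquiv ℂ (CuspForm (Gamma0 N) (n + 2))).surjective ψ
  have h0 : f = 0 := by
    refine eq_zero_of_forall_re_cuspidalLatticeK_eq_zero n hn f fun φ hφ ↦ ?_
    have h1 : ℓ φ = 0 := hker (Submodule.subset_span hφ)
    rw [← hψ, ← hf] at h1
    simpa using h1
  apply hℓ
  ext φ
  rw [← hψ, ← hf, h0]
  simp

/-- The cuspidal lattice is finitely generated (a subgroup of the finitely generated
`periodLatticeK`, `ℤ` Noetherian). [folklore] -/
theorem cuspidalLatticeK_fg : (cuspidalLatticeK (N := N) n).FG := by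
  set Λ := AddSubgroup.toIntSubmodule (periodLatticeK (N := N) n)
  have hΛ : Λ.FG := (Submodule.fg_iff_addSubgroup_fg _).mpr (periodLatticeK_fg N n)
  haveI : IsNoetherian ℤ Λ := isNoetherian_of_fg_of_noetherian _ hΛ
  have hle : AddSubgroup.toIntSubmodule (cuspidalLatticeK (N := N) n) ≤ Λ :=
    AddSubgroup.toIntSubmodule.le_iff_le.mpr (cuspidalLatticeK_le_periodLatticeK n)
  have hfg : (AddSubgroup.toIntSubmodule (cuspidalLatticeK (N := N) n)).FG :=
    isNoetherian_submodule.mp inferInstance _ hle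
  exact (Submodule.fg_iff_addSubgroup_fg _).mp hfg

end Separation

/-! ### Assembly -/

section Assembly

variable (N : ℕ) [NeZero N]

/-- **A Hecke-stable full lattice in `S_{n+2}(Γ₀(N))^∨` for even `n ≥ 2`**: a `ℤ`-basis of the
cuspidal period lattice `C` (finitely generated of `ℚ`-rank `≤ 2 dim_ℂ S`, spanning `S^∨` over
`ℝ`, Hecke stable) is an `ℝ`-basis of `S^∨` with `T_p^∨`-stable `ℤ`-span; dualise
(`gamma0_exists_heckeStableLattice_of_dual_basis`). [cite: Shimura1971, Thm. 3.48 and (3.5.20)] -/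
theorem gamma0_exists_heckeStableLattice_even (n : ℕ) (hn : Even n) (hn0 : n ≠ 0) :
    gamma0_exists_heckeStableLattice N ((n : ℤ) + 2) := by
  apply gamma0_exists_heckeStableLattice_of_dual_basis
  haveI : FiniteDimensional ℂ (CuspForm (Gamma0 N) (n + 2)) :=
    finiteDimensional_cuspForm_gamma0 N (n + 2)
  haveI := finite_span_cuspidalLatticeK (N := N) n hn
  obtain ⟨s, hs⟩ := exists_coe_eq_span_range_of_finrank_span_le (cuspidalLatticeK (N := N) n)
    (cuspidalLatticeK_fg n) (finrank_span_cuspidalLatticeK_le (N := N) n hn hn0)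
  have hspan : ⊤ ≤ Submodule.span ℝ (Set.range s) := by
    rw [← cuspidalLatticeK_span_real_eq_top n hn, Submodule.span_le, hs]
    exact Submodule.span_le_restrictScalars ℤ ℝ _
  have hcard : Fintype.card (Fin (2 * Module.finrank ℂ (CuspForm (Gamma0 N) (n + 2)))) =
      Module.finrank ℝ (Module.Dual ℂ (CuspForm (Gamma0 N) (n + 2))) := by
    rw [Fintype.card_fin, finrank_real_of_complex, Subspace.dual_finrank_eq]
  have hli : LinearIndependent ℝ s := linearIndependent_of_top_le_span_of_card_eq_finrank hspan hcard
  have hlat : ∀ φ, φ ∈ cuspidalLatticeK (N := N) n ↔ φ ∈ Submodule.span ℤ (Set.range s) := fun φ ↦ by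
    rw [← SetLike.mem_coe, hs, SetLike.mem_coe]
  refine ⟨_, Module.Basis.mk hli hspan, fun p hp j ↦ ?_⟩
  haveI : NeZero p := ⟨hp.ne_zero⟩
  rw [Module.Basis.coe_mk, ← hlat]
  exact dualMap_heckeT_mem_cuspidalLatticeK n hp
    ((hlat _).mpr (Submodule.subset_span (Set.mem_range_self j)))

variable (k : ℤ)

/-- **Shimura's Theorem 3.48 / (3.5.20) for `Γ₀(N)`, all weights: `S_k(Γ₀(N))` has a basis whose
`ℤ`-span is stable under every `T_p` (`p` prime) and which is an `ℝ`-basis of its real span** —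
the discharge of `gamma0_exists_heckeStableLattice`. Weights `k < 2`, odd `k`, `k = 2`:
`gamma0_exists_heckeStableLattice_of_not_even_or_lt_four`; even `k ≥ 4`:
`gamma0_exists_heckeStableLattice_even`. [cite: Shimura1971, Thm. 3.48 and (3.5.20) p. 84; §8.4 pp. 239–241] -/
theorem gamma0_exists_heckeStableLattice_holds : gamma0_exists_heckeStableLattice N k := by
  by_cases h : ¬Even k ∨ k < 4
  · exact gamma0_exists_heckeStableLattice_of_not_even_or_lt_four N k h
  · push Not at h
    obtain ⟨hk, hk4⟩ := h
    obtain ⟨m, hm⟩ : ∃ m : ℕ, (m : ℤ) = k - 2 := ⟨(k - 2).toNat, Int.toNat_of_nonneg (by omega)⟩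
    have hme : Even m := by
      have : Even ((m : ℤ)) := by rw [hm]; exact hk.sub even_two
      exact (Int.even_coe_nat m).mp this
    have hm0 : m ≠ 0 := by
      intro h0
      rw [h0] at hm
      push_cast at hm
      omega
    have := gamma0_exists_heckeStableLattice_even N m hme hm0
    rwa [hm, sub_add_cancel] at this

end Assembly

end Literature.NumberTheory.EllipticCurves.ModularForms
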